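import Summits.ResolutionOfSingularities.ResolutionOfSingularities.Theorems.HilbertSamuelEliminationSigmaMaxModificationsCorridor3WLadderMovingRows
import Summits.ResolutionOfSingularities.ResolutionOfSingularities.Theorems.HilbertSamuelEliminationCampaignW42TertiaryCycles
import Literature.AlgebraicGeometry.Resolution.PointBlowupHsFunMono
import Literature.AlgebraicGeometry.CossartJannsenSaito2020.KeyTheoremsIsolated
import Literature.AlgebraicGeometry.CossartJannsenSaito2020.NearPointDirectrix
import Mathlib.RingTheory.KrullDimension.Zero
import HarnessLib

/-!
# [OURS · L1 W4.2] THE CYCLE PACKAGE ALONG `Reaches`, and: A GENUINE STEP AT A POINT ISOLATED IN THE HILBERT–SAMUEL LOCUS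
# BLOWS UP THAT POINT (the centre's stalk ideal is the maximal ideal) — crux chain w42, line `w_ladder` v6, shared brick for
# the W-low bridges (grade 1 `Bridge3SeqM`, third door `IsoLowDirDimTerminatesQM`, units-half `UnitTowerExtractionQM`) and C′

OURS (cell res-hironaka, slot W4.2, LEAD PROVER res-L1-w42-lead-1 gen 3); NOT statements of H. Hironaka's manuscript
[Hironaka2017] nor of [CossartJannsenSaito2020]; AI proving, weaker than expert review. `--supports stmt-ResolutionOfSingularities-19249`.

WHAT IS PROVED (sorry-free, no named fact used).
* §1 `CycleInv k N ν s` — the s42 CYCLE INVARIANT (hypotheses of `CampaignW42.isCanonicalStep_cycle_package`: finite type over the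
  field `k`, reduced, `dim ≤ N`, `ν` never exceeded, labels `≤` year, the replayed subscheme = its label part with permissible remaining
  centres and regular last stage) READ ON A MARKED STAGE; it holds at every maximal origin (`CycleInv.init`, `ν` arbitrary) and
  PROPAGATES ALONG CANONICAL NEAR STEPS for `ν ≠ Φ^{(N)}` (`CycleInv.step`, `CycleInv.of_reaches`); at such a stage the centre `C` of any
  canonical step is REGULAR, lies in `X_n(ν)`, is PERMISSIBLE, and `H^N` does not increase along `Bl_C` (`CycleInv.centre`) — the
  marked-stage form of `cycleInvariant_runs` (which is phrased on `CentreSeq` runs).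
* §2 `ringKrullDim_stalk_quot_stalkIdeal_eq_zero_of_isolated` — for an ideal sheaf `C` on `W` and a point `x` with an open `U`,
  `U ∩ V(C) = {x}`: `dim (𝒪_{W,x} ⧸ C_x) = 0` (the local ring of `V(C)` at its isolated point `x` has dimension `0`: `{x}` is open in
  `V(C)`, so `x` is maximal for generization, Mathlib `ringKrullDim_stalk_eq_coheight`); `stalkIdeal_eq_maximalIdeal_of_isolated_of_isRegular`
  — if moreover `V(C)` is regular then `C_x = 𝔪_x` (a regular local ring of dimension `0` is a field).
* §3 HEADLINE `stalkIdeal_centre_eq_maximalIdeal_of_isIsolated` — at a stage carrying the cycle invariant (`ν ≠ Φ^{(N)}`), if the marked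
  point `x_n` is ISOLATED IN THE HILBERT–SAMUEL LOCUS (`IsIsolatedInHSMaxLocus`, CJS Def. 13.3 / Cor. 6.37; the module's `Moving.Iso`) and
  the canonical step is GENUINE at `x_n` (`x_n ∈ V(C)`), then `C_{x_n} = 𝔪_{x_n}` and `dim 𝒪_{X_n,x_n}/C_{x_n} = 0`: LOCALLY AT `x_n` THE
  CANONICAL STEP IS THE BLOW-UP OF THE POINT `x_n` — because `V(C) ⊆ X_n(ν) ⊆ (X_n)_max` (the stratum of the never-exceeded value is
  in the Hilbert–Samuel locus) meets the isolating open only in `x_n`, and `V(C)` is regular. In-scope form from a maximal origin: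
  `stalkIdeal_centre_eq_maximalIdeal_of_reaches`. With the numerical Thm. 3.14 (`CossartJannsenSaito2020_thm_3_14`, p499700) this is
  the entry «`dim 𝒪_{D,x} = 0`», so a near point over such an `x_n` forces `1 ≤ e_{x_n}` in the (F1) range
  (`one_le_dirDim_of_near_of_isIsolated`).

## References

* V. Cossart, U. Jannsen, S. Saito, LNM 2270 (2020), Rem. 6.29 (1), p. 92, Lemma 5.34 (3), Thm. 3.3, Def. 6.34 (i), Def. 13.3,
  Cor. 6.37, Thm. 3.14. [CossartJannsenSaito2020]
* The Stacks Project, Tag 02IZ (dimension of the local ring = codimension of the point). [StacksProject]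
-/

noncomputable section

set_option linter.dupNamespace false -- mandated namespace of this single-conjunct summit

open CategoryTheory AlgebraicGeometry TopologicalSpace Topology IsLocalRing
open Literature.AlgebraicGeometry.Resolution Literature.RingTheory.HilbertSamuel
open Literature.AlgebraicGeometry.CossartJannsenSaito2020
open Summit.ResolutionOfSingularities.ResolutionOfSingularities.Theorems.CampaignW42

namespace Summit.ResolutionOfSingularities.ResolutionOfSingularities.Theorems.SigmaMaxModificationsCorridor3.Helpers

universe u

/-! ## §2 (general) An isolated point of a closed subscheme: dimension `0`; regular ⇒ the stalk ideal is maximal -/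

/-- **The local ring of `V(C)` at an ISOLATED point has dimension `0`**, read on `W`: if an open `U` meets `V(C)` exactly in `x`, then
`dim (𝒪_{W,x} ⧸ C_x) = 0` (`𝒪_{W,x}/C_x ≅ 𝒪_{V(C),x}`, and `x`, being open in `V(C)`, has no proper generization there; Stacks 02IZ).
[cite: StacksProject, Tag 02IZ] -/
theorem ringKrullDim_stalk_quot_stalkIdeal_eq_zero_of_isolated {W : Scheme.{u}} (C : W.IdealSheafData) {x : W} {U : Set W}
    (hU : IsOpen U) (hx : U ∩ (C.support : Set W) = {x}) :
    ringKrullDim (W.presheaf.stalk x ⧸ stalkIdeal C x) = 0 := by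
  have hxC : x ∈ (C.support : Set W) := (hx.symm ▸ Set.mem_singleton x : x ∈ U ∩ (C.support : Set W)).2
  have hxU : x ∈ U := (hx.symm ▸ Set.mem_singleton x : x ∈ U ∩ (C.support : Set W)).1
  -- the point `z` of `V(C)` over `x`
  have hrange : Set.range C.subschemeι.base = (C.support : Set W) := Scheme.IdealSheafData.range_subschemeι C
  obtain ⟨z, hz⟩ : x ∈ Set.range C.subschemeι.base := hrange ▸ hxC
  -- `𝒪_{W,x}/C_x ≅ 𝒪_{V(C),z}`
  have hsurj : Function.Surjective (C.subschemeι.stalkMap z).hom := C.subschemeι.stalkMap_surjective z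
  have hker : RingHom.ker (C.subschemeι.stalkMap z).hom = stalkIdeal C (C.subschemeι.base z) := by
    rw [← stalkIdeal_ker_eq_ker_stalkMap C.subschemeι z, Scheme.IdealSheafData.ker_subschemeι]
  subst hz
  let e : (W.presheaf.stalk (C.subschemeι.base z) ⧸ stalkIdeal C (C.subschemeι.base z)) ≃+*
      C.subscheme.presheaf.stalk z :=
    (Ideal.quotEquivOfEq hker.symm).trans (RingHom.quotientKerEquivOfSurjective hsurj)
  rw [e.ringKrullDim, ringKrullDim_stalk_eq_coheight]
  -- `z` is maximal for generization: `{z}` is open in `V(C)`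
  have hinj : Function.Injective C.subschemeι.base := C.subschemeι.isClosedEmbedding.injective
  have hopen : IsOpen ({z} : Set C.subscheme) := by
    have h1 : C.subschemeι.base ⁻¹' U = {z} := by
      ext y
      simp only [Set.mem_preimage, Set.mem_singleton_iff]
      constructor
      · intro hy
        have hy' : C.subschemeι.base y ∈ U ∩ (C.support : Set W) := ⟨hy, hrange ▸ Set.mem_range_self y⟩
        rw [hx, Set.mem_singleton_iff] at hy'
        exact hinj hy'
      · rintro rfl; exact hxU
    rw [← h1]
    exact hU.preimage C.subschemeι.base.hom.continuous
  have hmax : IsMax z := by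
    intro y hy
    rw [AlgebraicGeometry.Scheme.le_iff_specializes] at hy
    have hmem : y ∈ ({z} : Set C.subscheme) := hy.mem_open hopen rfl
    rw [Set.mem_singleton_iff.mp hmem]
  rw [Order.coheight_eq_zero.mpr hmax]
  rfl

/-- **At an isolated point of a REGULAR closed subscheme `V(C)` the stalk ideal is the maximal ideal**: `𝒪_{W,x}/C_x` is a regular
local ring (tree `isRegularLocalRing_stalk_subscheme_iff`) of dimension `0`, hence a field, so `C_x` is maximal, `= 𝔪_x`. [folklore] -/
theorem stalkIdeal_eq_maximalIdeal_of_isolated_of_isRegular {W : Scheme.{u}} (C : W.IdealSheafData)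
    (hreg : Literature.AlgebraicGeometry.Resolution.Scheme.IsRegular C.subscheme) {x : W} {U : Set W} (hU : IsOpen U)
    (hx : U ∩ (C.support : Set W) = {x}) : stalkIdeal C x = maximalIdeal (W.presheaf.stalk x) := by
  have hxC : x ∈ (C.support : Set W) := (hx.symm ▸ Set.mem_singleton x : x ∈ U ∩ (C.support : Set W)).2
  have hrange : Set.range C.subschemeι.base = (C.support : Set W) := Scheme.IdealSheafData.range_subschemeι C
  obtain ⟨z, hz⟩ : x ∈ Set.range C.subschemeι.base := hrange ▸ hxC
  have hdim := ringKrullDim_stalk_quot_stalkIdeal_eq_zero_of_isolated C hU hx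
  subst hz
  haveI hregq : IsRegularLocalRing (W.presheaf.stalk (C.subschemeι.base z) ⧸ stalkIdeal C (C.subschemeι.base z)) :=
    (isRegularLocalRing_stalk_subscheme_iff C z).mp (hreg z)
  haveI : IsDomain (W.presheaf.stalk (C.subschemeι.base z) ⧸ stalkIdeal C (C.subschemeι.base z)) :=
    isDomain_of_isRegularLocalRing _
  haveI : Ring.KrullDimLE 0 (W.presheaf.stalk (C.subschemeι.base z) ⧸ stalkIdeal C (C.subschemeι.base z)) := by
    rw [Ring.krullDimLE_iff, hdim]; rfl
  have hfield : IsField (W.presheaf.stalk (C.subschemeι.base z) ⧸ stalkIdeal C (C.subschemeι.base z)) :=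
    Ring.KrullDimLE.isField_of_isDomain
  exact IsLocalRing.eq_maximalIdeal (Ideal.Quotient.maximal_of_isField _ hfield)

/-! ## §1 The cycle invariant read on marked stages, along `Reaches` -/

/-- [OURS · L1 W4.2] THE CYCLE INVARIANT OF `S(X, ν)` AT A MARKED STAGE (the hypotheses of `CampaignW42.isCanonicalStep_cycle_package`
over the ground field `k`): the stage is of finite type over `k`, reduced, `dim ≤ N`, `ν` is never exceeded by `H^N`, every label is
`≤` the year, and the cycle in progress (if any) replays a label part with permissible remaining centres and a regular last stage.
OURS bookkeeping (the oracle does not enter); NOT a statement of the manuscript. [cite: CossartJannsenSaito2020, Rem. 6.29 (1), p. 92] -/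
def CycleInv (k : Type u) [Field k] (N : ℕ) (ν : ℕ → ℕ) (s : MarkedStage.{u}) : Prop :=
  (∃ f : s.W ⟶ Spec (.of k), LocallyOfFiniteType f ∧ QuasiCompact f) ∧ IsReduced s.W ∧
    topologicalKrullDim s.W ≤ (N : WithBot ℕ∞) ∧ (∀ w : s.W, ν ≤ Scheme.hsFun s.W N w → Scheme.hsFun s.W N w = ν) ∧
    (∀ Z, s.L.label Z ≤ s.L.year) ∧
    ∀ Q, s.P = some Q → Set.range Q.hom.base = s.L.part (Scheme.hsStratum s.W N ν) Q.lbl ∧ Q.lbl ≤ s.L.year ∧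
      Q.rest.AllPermissible ∧ Literature.AlgebraicGeometry.Resolution.Scheme.IsRegular Q.rest.top

variable {R : ∀ S : Scheme.{u}, CentreSeq S → Prop} {N : ℕ} {ν : ℕ → ℕ} {k : Type u} [Field k]

/-- The cycle invariant holds at every maximal origin (over its ground field). [folklore] -/
theorem CycleInv.init {p : ℕ} {X : Scheme.{u}} [IsLocallyNoetherian X] {x : X} (hX : IsMaximalOrigin p N ν X x) :
    ∃ (k : Type u) (_ : Field k), CycleInv k N ν (MarkedStage.init X x) := by
  obtain ⟨k, _, _, f, -, hft, hqc⟩ := hX.exists_structure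
  exact ⟨k, inferInstance, ⟨f, hft, hqc⟩, hX.isReduced, hX.dim_le, fun w hw => le_antisymm (hX.maximal.2 ⟨w, rfl⟩ hw) hw,
    fun _ => le_rfl, fun Q hQ => absurd hQ (by simp [MarkedStage.init])⟩

/-- **THE CENTRE OF A CANONICAL STEP FROM A STAGE CARRYING THE CYCLE INVARIANT** (`ν ≠ Φ^{(N)}`, admissible oracle) is REGULAR, lies in
the `ν`-stratum, is PERMISSIBLE, `H^N` does not increase along its blow-up, and the next state carries the invariant
(`isCanonicalStep_cycle_package` read on marked stages). [cite: CossartJannsenSaito2020, Rem. 6.29 (1), p. 92, Lemma 5.34 (3), Thm. 3.3] -/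
theorem CycleInv.centre (hRa : OracleAdmissible R) (hν : ν ≠ iterPSum N Phi) {s : MarkedStage.{u}} (h : CycleInv k N ν s)
    {C : s.W.IdealSheafData} {P' : Option (Pending (blowup C))} (hst : IsCanonicalStep R N ν s.L s.P C P') :
    Literature.AlgebraicGeometry.Resolution.Scheme.IsRegular C.subscheme ∧
      (C.support : Set s.W) ⊆ Scheme.hsStratum s.W N ν ∧ IdealSheafData.IsPermissible C ∧
      (∀ z : ↥(blowup C), Scheme.hsFun (blowup C) N z ≤ Scheme.hsFun s.W N ((blowup.π C).base z)) ∧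
      ∀ (hln : IsLocallyNoetherian (blowup C)) (x' : ↥(blowup C)),
        CycleInv k N ν ⟨blowup C, hln, s.L.next (Scheme.hsStratum s.W N ν) C, P', x'⟩ := by
  obtain ⟨hk, hred, hdim, hsup, hlab, hpend⟩ := h
  obtain ⟨hCreg, hCsub, hperm, hmono, hk', hred', hdim', hsup', hlab', hpend'⟩ :=
    isCanonicalStep_cycle_package (k := k) hRa hν hk hred hdim hsup hlab hpend hst
  exact ⟨hCreg, hCsub, hperm, hmono, fun _ _ => ⟨hk', hred', hdim', hsup', hlab', hpend'⟩⟩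

/-- The cycle invariant propagates along a canonical near step. [folklore] -/
theorem CycleInv.step (hRa : OracleAdmissible R) (hν : ν ≠ iterPSum N Phi) {s s' : MarkedStage.{u}} (h : CycleInv k N ν s)
    (hst : CanonicalNearStep R N ν s s') : CycleInv k N ν s' := by
  obtain ⟨C, P', hln, x', hcs, -, -, -, rfl⟩ := hst
  exact (h.centre hRa hν hcs).2.2.2.2 hln x'

/-- The cycle invariant propagates along `Reaches`. [folklore] -/
theorem CycleInv.of_reaches (hRa : OracleAdmissible R) (hν : ν ≠ iterPSum N Phi) {s₀ s : MarkedStage.{u}} (h : CycleInv k N ν s₀)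
    (hr : Reaches R N ν s₀ s) : CycleInv k N ν s := by
  induction hr with
  | refl => exact h
  | tail _ hst ih => exact ih.step hRa hν hst

/-- A stage carrying the cycle invariant is locally Noetherian (finite type over a field). [folklore] -/
theorem CycleInv.isLocallyNoetherian {s : MarkedStage.{u}} (h : CycleInv k N ν s) : IsLocallyNoetherian s.W := by
  obtain ⟨f, hf, -⟩ := h.1
  exact LocallyOfFiniteType.isLocallyNoetherian f

/-- Under «`ν` is never exceeded», the `ν`-stratum lies in the Hilbert–Samuel locus `X_max` (once it is non-empty, `ν` is a maximal
value). [cite: CossartJannsenSaito2020, Def. 2.35] -/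
theorem hsStratum_subset_hsMaxLocus_of_supMax {W : Scheme.{u}}
    (hsup : ∀ w : W, ν ≤ Scheme.hsFun W N w → Scheme.hsFun W N w = ν) :
    Scheme.hsStratum W N ν ⊆ Scheme.hsMaxLocus W N := by
  intro w hw
  rw [Scheme.mem_hsMaxLocus_iff, Scheme.mem_hsStratum_iff.mp hw]
  exact ⟨⟨w, Scheme.mem_hsStratum_iff.mp hw⟩, fun μ ⟨w', hw'⟩ hle => (hsup w' (hw' ▸ hle)).symm ▸ hw'.symm.le⟩

/-! ## §3 A genuine step at a point isolated in the Hilbert–Samuel locus blows up that point -/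

/-- **A GENUINE CANONICAL STEP AT A POINT ISOLATED IN THE HILBERT–SAMUEL LOCUS BLOWS UP THAT POINT (locally).** At a stage carrying
the cycle invariant (`ν ≠ Φ^{(N)}`, admissible oracle), if the marked point `x_n` is isolated in `(X_n)_max` (CJS Def. 13.3) and lies in
the centre `C` of the canonical step, then `C_{x_n} = 𝔪_{x_n}` and `dim 𝒪_{X_n,x_n}/C_{x_n} = 0`: `V(C)` is regular and contained in
`X_n(ν) ⊆ (X_n)_max`, which the isolating open meets only in `x_n`. (CJS Def. 6.34 (i) / Def. 6.38: the fundamental sequences and units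
over an isolated point START with the blow-up of the point.) [cite: CossartJannsenSaito2020, Def. 6.34 (i), Def. 13.3, Rem. 6.29 (1)] -/
theorem stalkIdeal_centre_eq_maximalIdeal_of_isIsolated (hRa : OracleAdmissible R) (hν : ν ≠ iterPSum N Phi)
    {s : MarkedStage.{u}} (h : CycleInv k N ν s) {C : s.W.IdealSheafData} {P' : Option (Pending (blowup C))}
    (hst : IsCanonicalStep R N ν s.L s.P C P') (hiso : @IsIsolatedInHSMaxLocus s.W s.ln N s.pt)
    (hx : s.pt ∈ (C.support : Set s.W)) :
    stalkIdeal C s.pt = maximalIdeal (s.W.presheaf.stalk s.pt) ∧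
      ringKrullDim (s.W.presheaf.stalk s.pt ⧸ stalkIdeal C s.pt) = 0 := by
  haveI : IsLocallyNoetherian s.W := s.ln
  obtain ⟨hCreg, hCsub, -, -, -⟩ := h.centre hRa hν hst
  obtain ⟨U, hU, hUmax⟩ := hiso
  have hsub : (C.support : Set s.W) ⊆ Scheme.hsMaxLocus s.W N :=
    hCsub.trans (hsStratum_subset_hsMaxLocus_of_supMax h.2.2.2.1)
  have hUx : U ∩ (C.support : Set s.W) = {s.pt} := by
    apply Set.Subset.antisymm
    · rintro y ⟨hyU, hyC⟩
      exact hUmax ▸ ⟨hyU, hsub hyC⟩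
    · rintro y rfl
      exact ⟨(hUmax.symm ▸ Set.mem_singleton s.pt : s.pt ∈ U ∩ Scheme.hsMaxLocus s.W N).1, hx⟩
  exact ⟨stalkIdeal_eq_maximalIdeal_of_isolated_of_isRegular C hCreg hU hUx,
    ringKrullDim_stalk_quot_stalkIdeal_eq_zero_of_isolated C hU hUx⟩

/-- **In-scope form.** Along `S(X, ν)` from a maximal origin (`ν ≠ Φ^{(N)}`, admissible oracle): at every reached stage whose marked
point is isolated in the Hilbert–Samuel locus, a GENUINE canonical step has centre stalk `𝔪_{x_n}` at the marked point.
[cite: CossartJannsenSaito2020, Def. 6.34 (i), Def. 13.3] -/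
theorem stalkIdeal_centre_eq_maximalIdeal_of_reaches (hRa : OracleAdmissible R) (hν : ν ≠ iterPSum N Phi) {p : ℕ}
    {X : Scheme.{u}} [IsLocallyNoetherian X] {x : X} (hX : IsMaximalOrigin p N ν X x) {s : MarkedStage.{u}}
    (hr : Reaches R N ν (MarkedStage.init X x) s) {C : s.W.IdealSheafData} {P' : Option (Pending (blowup C))}
    (hst : IsCanonicalStep R N ν s.L s.P C P') (hiso : @IsIsolatedInHSMaxLocus s.W s.ln N s.pt)
    (hx : s.pt ∈ (C.support : Set s.W)) :
    stalkIdeal C s.pt = maximalIdeal (s.W.presheaf.stalk s.pt) ∧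
      ringKrullDim (s.W.presheaf.stalk s.pt ⧸ stalkIdeal C s.pt) = 0 := by
  obtain ⟨k, _, h0⟩ := CycleInv.init hX
  exact stalkIdeal_centre_eq_maximalIdeal_of_isIsolated hRa hν (h0.of_reaches hRa hν hr) hst hiso hx

/-- **With CJS Thm. 3.14 (the tree's numerical named fact, p499700): a near point over a blown-up marked point that is isolated in the
Hilbert–Samuel locus forces `e_{x_n} ≥ 1`** in the (F1) range `CharHypothesis` — i.e. at such a point with `e_{x_n} = 0` NO near point
exists. (CJS, proof of Lemma 3.15: «If `e_x(X) = 0` … then there is no point of `Bℓ_D(X)` which is near to `x` by Theorem 3.14.»)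
[cite: CossartJannsenSaito2020, Thm. 3.14, Lemma 3.15] -/
theorem one_le_dirDim_of_near_of_isIsolated (h314 : CossartJannsenSaito2020_thm_3_14.{u}) (hRa : OracleAdmissible R)
    (hν : ν ≠ iterPSum N Phi) {s : MarkedStage.{u}} (h : CycleInv k N ν s) {C : s.W.IdealSheafData}
    {P' : Option (Pending (blowup C))} (hst : IsCanonicalStep R N ν s.L s.P C P') (hiso : @IsIsolatedInHSMaxLocus s.W s.ln N s.pt)
    (hchar : CharHypothesis s.W s.pt) {x' : ↥(blowup C)} (hπ : (blowup.π C).base x' = s.pt)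
    (hx' : x' ∈ Scheme.hsStratum (blowup C) N ν) (hmem : s.pt ∈ Scheme.hsStratum s.W N ν)
    (hx : s.pt ∈ (C.support : Set s.W)) : 1 ≤ @Scheme.dirDim s.W s.ln s.pt := by
  haveI : IsLocallyNoetherian s.W := s.ln
  obtain ⟨-, -, hperm, -, -⟩ := h.centre hRa hν hst
  have hdim0 := (stalkIdeal_centre_eq_maximalIdeal_of_isIsolated hRa hν h hst hiso hx).2
  obtain ⟨f, hf, -⟩ := h.1
  have hexc : Scheme.IsExcellent s.W := Scheme.isExcellent_of_locallyOfFiniteType Stacks07QW_field_holds f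
  have hnear : Scheme.hsFun (blowup C) N x' = Scheme.hsFun s.W N ((blowup.π C).base x') := by
    rw [Scheme.mem_hsStratum_iff.mp hx', hπ]; exact (Scheme.mem_hsStratum_iff.mp hmem).symm
  have hlt := h314 s.W (blowup C) (blowup.π C) C hexc hperm (blowup.isBlowup C) N h.2.2.1 x' (hπ.symm ▸ hx) (hπ.symm ▸ hchar) hnear
  rw [hπ, hdim0] at hlt
  have : (0 : WithBot ℕ∞) < (Scheme.dirDim s.W s.pt : WithBot ℕ∞) := hlt
  have h1 : 0 < Scheme.dirDim s.W s.pt := by exact_mod_cast this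
  exact h1

end Summit.ResolutionOfSingularities.ResolutionOfSingularities.Theorems.SigmaMaxModificationsCorridor3.Helpers

end
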